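import Literature.AlgebraicGeometry.Motives.FaltingsECEndCoreBaseChangeProofs
import Literature.NumberTheory.EllipticCurves.IsogenyClassFiniteProofs
import Literature.NumberTheory.EllipticCurves.TateModuleProjSurjectiveProofs
import Literature.NumberTheory.EllipticCurves.SupersingularUnramifiedNonabelianProofs
import HarnessLib

/-!
# Faltings 1983, Satz 4 for an elliptic curve: the core fact at an absolutely unramified place
# of odd residue degree with good supersingular reduction (Serre 1972, §1.11)

Theorem-only sequel of `FaltingsECEndCoreCasesProofs` / `FaltingsECEndCoreOrdinaryProofs` /
`FaltingsECEndCorePotentialCMProofs`.  The elliptic-curve input is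
`WeierstrassCurve.exists_smul_smul_ne_of_supersingular_unramified`
(`SupersingularUnramifiedNonabelianProofs`): for `E/K` over a number field, a prime `ℓ`, a
finite place `v` at which `ℓ` is a uniformizer (`v ∣ ℓ`, `e(v ∣ ℓ) = 1`) with residue field of
odd degree over `𝔽_ℓ`, and a good model of `E` at `v` with supersingular reduction, two elements
of `Γ_K` do not commute on `E[ℓ]`.  Hence they do not commute on `V_ℓ E`
(`rationalGaloisRepTate_mul_ne_of_smul_smul_ne`: `T_ℓ E → E[ℓ]` is onto and `T_ℓ E → V_ℓ E` is
injective), so by the tree's `exists_eq_smul_one_of_equivariant_iff_exists_mul_ne_mul` **every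
`Γ_K`-equivariant endomorphism of `V_ℓ E` is a scalar** — the core statement of Satz 4, here even
without the hypothesis "no `Γ_K`-stable line" — and the named fact
`exists_eq_smul_one_of_equivariant_of_not_hasRationalCM W ℓ`, Faltings' Satz 4
(`mem_span_range_tateEndRingHom_iff`), the subspace statement for `E × E`
(`stable_subspace_prod_eq_range`) and Korollar 1 for `(E, E)` follow unconditionally for such
`(E, ℓ, v)`, also when the place lies in a finite extension `L/K` (`…_of_extension`, descent of
`FaltingsECEndCoreBaseChangeProofs`).  This is the supersingular companion of the ordinary case
(`…_of_isUnit_hasseCoeff`): together, **a place `v ∣ ℓ` of `K` (or of a finite extension) which is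
absolutely unramified of odd residue degree and of good reduction for `E` settles Satz 4 at `ℓ`**.

## References

* [Serre1972] J.-P. Serre, Invent. Math. 15 (1972), §1.11, Prop. 11–12.
* [SerreAbelianLadic1968] J.-P. Serre, *Abelian ℓ-adic representations and elliptic curves*
  (1968), IV.2.2.
* [Faltings1983Endlichkeit] G. Faltings, Invent. Math. 73 (1983), §5 Satz 4 and Korollar 1.
-/

noncomputable section

open scoped TensorProduct

universe u

namespace Literature.AlgebraicGeometry.Motives

open WeierstrassCurve Module Literature.NumberTheory.EllipticCurves
  Literature.NumberTheory.GaloisRepresentations Field IsDedekindDomain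
open scoped NumberField

variable {K : Type u} [Field K] (W : WeierstrassCurve K) (ℓ : ℕ) [hℓ : Fact ℓ.Prime]

/-- **Non-commutation on `E[ℓ]` gives non-commutation on `V_ℓ E`.**  If `σ τ P ≠ τ σ P` for some
`P ∈ E[ℓ]`, then `ρ_ℓ(σ) ρ_ℓ(τ) ≠ ρ_ℓ(τ) ρ_ℓ(σ)` on `V_ℓ E`: lift `P` to `a ∈ T_ℓ E`
(`proj_surjective_of_isAlgClosed_holds`), compare in `V_ℓ E` (`T_ℓ E → V_ℓ E` is injective,
`TateModule.toRational_injective`) and project back to level `1`. [folklore] -/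
theorem rationalGaloisRepTate_mul_ne_of_smul_smul_ne [W.IsElliptic]
    {σ τ : Field.absoluteGaloisGroup K} {P : geomPoints W} (hP : P ∈ geomTorsion W ℓ)
    (hne : σ • τ • P ≠ τ • σ • P) :
    rationalGaloisRepTate W ℓ σ * rationalGaloisRepTate W ℓ τ ≠
      rationalGaloisRepTate W ℓ τ * rationalGaloisRepTate W ℓ σ := by
  intro heq
  apply hne
  have hP' : P ∈ geomTorsion W ((ℓ ^ 1 : ℕ) : ℤ) := by rwa [pow_one]
  obtain ⟨a, ha⟩ := proj_surjective_of_isAlgClosed_holds W ℓ 1 hP'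
  have e : ∀ (g : Field.absoluteGaloisGroup K) (x : W.tateModule ℓ),
      rationalGaloisRepTate W ℓ g (TateModule.toRational ℓ x) = TateModule.toRational ℓ (g • x) :=
    fun g x ↦ rationalTateRepresentation_toRational _ _ ℓ g x
  have hT : σ • τ • a = τ • σ • a := by
    apply TateModule.toRational_injective (p := ℓ)
    have h1 := LinearMap.congr_fun heq (TateModule.toRational ℓ a)
    rw [Module.End.mul_apply, Module.End.mul_apply, e, e, e, e] at h1
    exact h1
  have h2 := congrArg (TateModule.proj ℓ 1) hT
  rw [TateModule.proj_smul_of_distribMulAction, TateModule.proj_smul_of_distribMulAction,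
    TateModule.proj_smul_of_distribMulAction, TateModule.proj_smul_of_distribMulAction, ha] at h2
  exact h2

/-- **The core of Satz 4 at an absolutely unramified supersingular place of odd residue degree**
(Serre 1972, §1.11, Prop. 12): for `E/K` over a number field, `ℓ` a prime, `v` a finite place with
`v.valuation K ℓ = exp (-1)` (`ℓ` is a uniformizer at `v`) and `#(𝓞 K ⧸ v) = ℓᶠ` with `f` odd,
and a good model `M/𝓞_v` of `E` at `v` with supersingular reduction (`a₁(M) ∈ 𝔪_v` if `ℓ = 2`,
`A_ℓ(M) ∈ 𝔪_v` otherwise), **every `Γ_K`-equivariant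
endomorphism of `V_ℓ E` is a scalar** (no hypothesis on stable lines or on `End_K(E)`).
[cite: Serre1972, §1.11 Prop. 12] [cite: SerreAbelianLadic1968, IV.2.2] -/
theorem exists_eq_smul_one_of_equivariant_of_supersingular_unramified [NumberField K]
    [W.IsElliptic] {v : HeightOneSpectrum (𝓞 K)}
    (hℓv : v.valuation K (ℓ : K) = WithZero.exp (-1 : ℤ))
    {f : ℕ} (hf : Odd f) (hq : Nat.card (𝓞 K ⧸ v.asIdeal) = ℓ ^ f)
    {C : VariableChange (v.adicCompletion K)} {M : WeierstrassCurve (v.adicCompletionIntegers K)}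
    (hCM : C • W.baseChange (v.adicCompletion K) =
      M.map (algebraMap (v.adicCompletionIntegers K) (v.adicCompletion K))) (hΔ : IsUnit M.Δ)
    (hA : (if ℓ = 2 then M.a₁ else M.hasseCoeff ℓ) ∈
      IsLocalRing.maximalIdeal (v.adicCompletionIntegers K))
    (G : Module.End ℚ_[ℓ] (W.rationalTateModule ℓ))
    (hG : ∀ (σ : Field.absoluteGaloisGroup K) (v : W.rationalTateModule ℓ),
      G (rationalGaloisRepTate W ℓ σ v) = rationalGaloisRepTate W ℓ σ (G v)) :
    ∃ c : ℚ_[ℓ], G = c • 1 := by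
  have hℓK : (ℓ : K) ≠ 0 := Nat.cast_ne_zero.mpr hℓ.out.ne_zero
  obtain ⟨σ, τ, P, hP, hne⟩ :=
    W.exists_smul_smul_ne_of_supersingular_unramified hℓv hf hq hCM hΔ hA
  exact (exists_eq_smul_one_of_equivariant_iff_exists_mul_ne_mul W ℓ hℓK).mpr
    ⟨σ, τ, rationalGaloisRepTate_mul_ne_of_smul_smul_ne W ℓ hP hne⟩ G hG

/-- **The named core fact** `exists_eq_smul_one_of_equivariant_of_not_hasRationalCM W ℓ` at an
absolutely unramified supersingular place of odd residue degree.
[cite: Faltings1983Endlichkeit, §5 Satz 4 (⊗ ℚ_ℓ form)] [cite: Serre1972, §1.11 Prop. 12] -/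
theorem exists_eq_smul_one_of_equivariant_of_not_hasRationalCM_of_supersingular_unramified
    [NumberField K] [W.IsElliptic] {v : HeightOneSpectrum (𝓞 K)}
    (hℓv : v.valuation K (ℓ : K) = WithZero.exp (-1 : ℤ))
    {f : ℕ} (hf : Odd f) (hq : Nat.card (𝓞 K ⧸ v.asIdeal) = ℓ ^ f)
    {C : VariableChange (v.adicCompletion K)} {M : WeierstrassCurve (v.adicCompletionIntegers K)}
    (hCM : C • W.baseChange (v.adicCompletion K) =
      M.map (algebraMap (v.adicCompletionIntegers K) (v.adicCompletion K))) (hΔ : IsUnit M.Δ)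
    (hA : (if ℓ = 2 then M.a₁ else M.hasseCoeff ℓ) ∈
      IsLocalRing.maximalIdeal (v.adicCompletionIntegers K)) :
    exists_eq_smul_one_of_equivariant_of_not_hasRationalCM W ℓ := by
  intro _ _ _ _ G hG
  exact exists_eq_smul_one_of_equivariant_of_supersingular_unramified W ℓ hℓv hf hq hCM hΔ hA G hG

/-- **Faltings' Satz 4** (`End_K(E) ⊗ ℤ_ℓ ≅ End_{Γ_K}(T_ℓ E)`, the named fact
`mem_span_range_tateEndRingHom_iff W ℓ`) at an absolutely unramified supersingular place of odd
residue degree — unconditional. [cite: Faltings1983Endlichkeit, §5 Satz 4] -/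
theorem mem_span_range_tateEndRingHom_iff_of_supersingular_unramified
    [NumberField K] [W.IsElliptic] {v : HeightOneSpectrum (𝓞 K)}
    (hℓv : v.valuation K (ℓ : K) = WithZero.exp (-1 : ℤ))
    {f : ℕ} (hf : Odd f) (hq : Nat.card (𝓞 K ⧸ v.asIdeal) = ℓ ^ f)
    {C : VariableChange (v.adicCompletion K)} {M : WeierstrassCurve (v.adicCompletionIntegers K)}
    (hCM : C • W.baseChange (v.adicCompletion K) =
      M.map (algebraMap (v.adicCompletionIntegers K) (v.adicCompletion K))) (hΔ : IsUnit M.Δ)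
    (hA : (if ℓ = 2 then M.a₁ else M.hasseCoeff ℓ) ∈
      IsLocalRing.maximalIdeal (v.adicCompletionIntegers K)) :
    mem_span_range_tateEndRingHom_iff W ℓ := by
  intro _ _
  exact mem_span_range_tateEndRingHom_iff_of_isogenyClass_of_core W ℓ (finite_isogenyClass_holds W)
    (exists_eq_smul_one_of_equivariant_of_not_hasRationalCM_of_supersingular_unramified W ℓ hℓv hf hq
      hCM hΔ hA)

/-- **Faltings' subspace statement for `E × E`** (the named fact
`stable_subspace_prod_eq_range W ℓ`) at an absolutely unramified supersingular place of odd
residue degree — unconditional. [cite: Faltings1983Endlichkeit, §5, Sätze 3–4] -/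
theorem stable_subspace_prod_eq_range_of_supersingular_unramified
    [NumberField K] [W.IsElliptic] {v : HeightOneSpectrum (𝓞 K)}
    (hℓv : v.valuation K (ℓ : K) = WithZero.exp (-1 : ℤ))
    {f : ℕ} (hf : Odd f) (hq : Nat.card (𝓞 K ⧸ v.asIdeal) = ℓ ^ f)
    {C : VariableChange (v.adicCompletion K)} {M : WeierstrassCurve (v.adicCompletionIntegers K)}
    (hCM : C • W.baseChange (v.adicCompletion K) =
      M.map (algebraMap (v.adicCompletionIntegers K) (v.adicCompletion K))) (hΔ : IsUnit M.Δ)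
    (hA : (if ℓ = 2 then M.a₁ else M.hasseCoeff ℓ) ∈
      IsLocalRing.maximalIdeal (v.adicCompletionIntegers K)) :
    stable_subspace_prod_eq_range W ℓ := by
  intro _ _
  exact stable_subspace_prod_eq_range_of_core W ℓ
    (exists_eq_smul_one_of_equivariant_of_not_hasRationalCM_of_supersingular_unramified W ℓ hℓv hf hq
      hCM hΔ hA)

/-- **Faltings' Korollar 1 for `(E, E)`** (the named fact
`mem_span_range_tateModule_map_of_equivariant W W ℓ`) at an absolutely unramified supersingular
place of odd residue degree — unconditional.
[cite: Faltings1983Endlichkeit, §5 Satz 4, Korollar 1] -/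
theorem mem_span_range_tateModule_map_of_equivariant_self_of_supersingular_unramified
    [NumberField K] [W.IsElliptic] {v : HeightOneSpectrum (𝓞 K)}
    (hℓv : v.valuation K (ℓ : K) = WithZero.exp (-1 : ℤ))
    {f : ℕ} (hf : Odd f) (hq : Nat.card (𝓞 K ⧸ v.asIdeal) = ℓ ^ f)
    {C : VariableChange (v.adicCompletion K)} {M : WeierstrassCurve (v.adicCompletionIntegers K)}
    (hCM : C • W.baseChange (v.adicCompletion K) =
      M.map (algebraMap (v.adicCompletionIntegers K) (v.adicCompletion K))) (hΔ : IsUnit M.Δ)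
    (hA : (if ℓ = 2 then M.a₁ else M.hasseCoeff ℓ) ∈
      IsLocalRing.maximalIdeal (v.adicCompletionIntegers K)) :
    mem_span_range_tateModule_map_of_equivariant W W ℓ := by
  intro _ _ _
  exact mem_span_range_tateModule_map_of_equivariant_self_of_isogenyClass_of_core W ℓ
    (finite_isogenyClass_holds W)
    (exists_eq_smul_one_of_equivariant_of_not_hasRationalCM_of_supersingular_unramified W ℓ hℓv hf hq
      hCM hΔ hA)

/-- **The named core fact for a curve acquiring an absolutely unramified supersingular place of
odd residue degree over a finite extension `L/K`** (descent along `L/K`,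
`FaltingsECEndCoreBaseChangeProofs`).
[cite: Faltings1983Endlichkeit, §5 Satz 4] [cite: Serre1972, §1.11 Prop. 12] -/
theorem exists_eq_smul_one_of_equivariant_of_not_hasRationalCM_of_supersingular_unramified_of_extension
    (L : Type u) [Field L] [NumberField L] [Algebra K L] {w : HeightOneSpectrum (𝓞 L)}
    (hℓw : w.valuation L (ℓ : L) = WithZero.exp (-1 : ℤ))
    {f : ℕ} (hf : Odd f) (hq : Nat.card (𝓞 L ⧸ w.asIdeal) = ℓ ^ f)
    {C : VariableChange (w.adicCompletion L)} {M : WeierstrassCurve (w.adicCompletionIntegers L)}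
    (hCM : C • (W.baseChange L).baseChange (w.adicCompletion L) =
      M.map (algebraMap (w.adicCompletionIntegers L) (w.adicCompletion L))) (hΔ : IsUnit M.Δ)
    (hA : (if ℓ = 2 then M.a₁ else M.hasseCoeff ℓ) ∈
      IsLocalRing.maximalIdeal (w.adicCompletionIntegers L)) :
    exists_eq_smul_one_of_equivariant_of_not_hasRationalCM W ℓ := by
  refine exists_eq_smul_one_of_equivariant_of_not_hasRationalCM_of_extension W ℓ L ?_
  intro _ _ _ G' hG'
  exact exists_eq_smul_one_of_equivariant_of_supersingular_unramified (W.baseChange L) ℓ hℓw hf hq hCM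
    hΔ hA G' hG'

/-- **The subspace statement for `E × E`** for a curve acquiring an absolutely unramified
supersingular place of odd residue degree over a finite extension — unconditional.
[cite: Faltings1983Endlichkeit, §5, Sätze 3–4] -/
theorem stable_subspace_prod_eq_range_of_supersingular_unramified_of_extension
    (L : Type u) [Field L] [NumberField L] [Algebra K L] {w : HeightOneSpectrum (𝓞 L)}
    (hℓw : w.valuation L (ℓ : L) = WithZero.exp (-1 : ℤ))
    {f : ℕ} (hf : Odd f) (hq : Nat.card (𝓞 L ⧸ w.asIdeal) = ℓ ^ f)
    {C : VariableChange (w.adicCompletion L)} {M : WeierstrassCurve (w.adicCompletionIntegers L)}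
    (hCM : C • (W.baseChange L).baseChange (w.adicCompletion L) =
      M.map (algebraMap (w.adicCompletionIntegers L) (w.adicCompletion L))) (hΔ : IsUnit M.Δ)
    (hA : (if ℓ = 2 then M.a₁ else M.hasseCoeff ℓ) ∈
      IsLocalRing.maximalIdeal (w.adicCompletionIntegers L)) :
    stable_subspace_prod_eq_range W ℓ :=
  stable_subspace_prod_eq_range_of_core W ℓ
    (exists_eq_smul_one_of_equivariant_of_not_hasRationalCM_of_supersingular_unramified_of_extension
      W ℓ L hℓw hf hq hCM hΔ hA)

end Literature.AlgebraicGeometry.Motives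

end
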